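import Summits.ABC.IUTFork.Cor312LogKummerRouteGlobal
import Summits.ABC.IUTFork.Cor312LogKummerRoute2Checks
import HarnessLib

/-!
# [IUTchIII] Cor. 3.12 — the GLOBAL log-Kummer input as a NAMED statement, with its independence
# (TEAM B, (G1′) compliance: the adjudicating-level B-INPUT)

Record-only file (D-0012) of the abc-iut cell (Cor. 3.12 strategy TEAM B «estimate / log-Kummer» of HUMAN
RULING D-0067, seat abc-iut-c312-11 = B1; compliance with plan/ADJUDICATION-SPEC.md v1.1 §2 (G1′) and
GAP-LEDGER row G-c312-11-1-SUPPLEMENT); TAKES NO SIDE. The route at print's global quantifier level is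
LANDED (abc-iut-w4-d022, `Cor312LogKummerRouteGlobal` p413209, hypotheses inline); the spec's (G)
grammar, however, wants the gap as ONE NAMED `Prop` over the frozen fields (§2 (G1)/(G2): "GapA a typed
Prop … carrying GapA VERBATIM (Lean signature)"). This file supplies exactly that and its independence:

* `GlobalVolumeTransport` / `GlobalVolumeTransportAt m₀` — the global (xi-g) input NAMED: for some
  assignment of lattice positions (resp. one position `m₀`, in the print the (xi-a) gluing position
  `m₀ = 0`) with finitely supported single-image volumes, the printed global `−|log(q)|` is at most the
  procession-normalized `v_ℚ`-summed log-volume of the chosen Kummer images of the Θ-pilot object. Both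
  compare two REAL NUMBERS built by the printed averaging — the (G1′)-admissible quantifier level; the
  right side stays PRE-HULL-sharp (single images; their sums are ≤ the hull sums), the strongest global
  statement the log-Kummer route uses — ref-b's locator verdict (spec §4 (ii)) decides its faithfulness
  grade vs print.
* `GlobalVolumeTransport.statement_of` / `GlobalVolumeTransportAt.statement_of` — the route at the
  global level, as consumers of the named statement (wrappers of p413209's
  `statement_of_globalVolumeTransport`; nothing re-proved).
* `globalVolumeTransport_of_volumeTransport` — PROVED: the per-packet B-INPUT implies the named global
  form with the finite-support side condition DERIVED, not assumed (the chosen single-image volumes are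
  sandwiched between `qLocal` and the hull volumes, both finitely supported — `support_finite_of_sandwich`).
  This strengthens p413209's `globalVolumeTransport_of_pointwise` (which takes the support condition as a
  hypothesis) and discharges the per-packet ⇒ global implication promised in G-c312-11-1-SUPPLEMENT.
* `not_globalVolumeTransport_of_not_statement`, `GapWitness.gapSetting_not_globalVolumeTransport`,
  `GapWitness.thm311_bridgeHyps_adm_not_imp_globalVolumeTransport` — PROVED: the named global input FAILS
  on Team A's gap witness, so it is NOT derivable from the whole typed Thm. 3.11 + bridge hypotheses +
  positivity + admissibility — the (G3) STRONG independence evidence at the (G1′) level.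
* Non-vacuity on the nonempty toy (`Checks`).

Sources: [IUTchIII] pp. 173–174 (statement), p. 184 l. 30–34 ((xi-g)), p. 185 l. 59 – p. 186 l. 3 (Step
(xii)); plan/ADJUDICATION-SPEC.md v1.1 §2 (G1′)/(G3). [claim: Mochizuki2012, status: disputed]
Deliberately NOT here: any claim that the global input holds for an instantiated real setting (the
adjudication target); which of this form or Team A's global `SoundAtInput` is the PRIMARY adjudicating
row (leads settle before the 11:30Z RESULT lines); any judgement.
-/

noncomputable section

namespace Summit.ABC

namespace IUTFork

namespace Cor312Vol

open Thm311 Cor312 Literature.IUT.LogThetaLattice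

variable {T : ThetaIndex} {S : Situation T} (P : Cor312.Setting S)

/-! ## 1. The named global forms -/

/-- **The global (xi-g) input, NAMED** ((G1′)-level; the inline-hypothesis route is p413209): for some
assignment of lattice positions `m i v_ℚ` with finitely supported single-image volumes, the printed
global `−|log(q)|` is at most the procession-normalized, `v_ℚ`-summed log-volume of the chosen Kummer
images of the Θ-pilot object. HYPOTHESIS — never asserted; Team B's adjudicating-level candidate.
[claim: Mochizuki2012, status: disputed] -/
@[claim "Mochizuki2012" "disputed"] def GlobalVolumeTransport : Prop :=
  ∃ m : Fin T.lstar → T.VQ → ℤ,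
    (∀ i : Fin T.lstar, (Function.support fun vQ => (S.D P.n).logvol (Setting.labelSucc i) vQ
      (P.thetaRegion (m i vQ) (Setting.labelSucc i) vQ)).Finite) ∧
    P.negLogQ ≤ processionNormalized fun i => ∑ᶠ vQ : T.VQ,
      (S.D P.n).logvol (Setting.labelSucc i) vQ (P.thetaRegion (m i vQ) (Setting.labelSucc i) vQ)

/-- The uniform form: one lattice position `m₀` — in the print, the (xi-a) gluing position `m₀ = 0` —
serves every packet. HYPOTHESIS. [claim: Mochizuki2012, status: disputed] -/
@[claim "Mochizuki2012" "disputed"] def GlobalVolumeTransportAt (m₀ : ℤ) : Prop :=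
  (∀ i : Fin T.lstar, (Function.support fun vQ => (S.D P.n).logvol (Setting.labelSucc i) vQ
    (P.thetaRegion m₀ (Setting.labelSucc i) vQ)).Finite) ∧
  P.negLogQ ≤ processionNormalized fun i => ∑ᶠ vQ : T.VQ,
    (S.D P.n).logvol (Setting.labelSucc i) vQ (P.thetaRegion m₀ (Setting.labelSucc i) vQ)

variable {P}

/-- The uniform form implies the general form. [folklore] -/
theorem globalVolumeTransport_of_at {m₀ : ℤ} (h : GlobalVolumeTransportAt P m₀) :
    GlobalVolumeTransport P :=
  ⟨fun _ _ => m₀, h.1, h.2⟩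

/-- The route at the global level as a consumer of the NAMED statement (wrapper of p413209's
`statement_of_globalVolumeTransport`). [claim: Mochizuki2012, status: disputed] -/
theorem GlobalVolumeTransport.statement_of (hgvt : GlobalVolumeTransport P) (H : BridgeHyps P)
    (hadm : ThetaRegionsAdm P) : P.Statement := by
  obtain ⟨m, hfin, hle⟩ := hgvt
  exact statement_of_globalVolumeTransport H hadm m hfin hle

/-- … and its uniform form. [claim: Mochizuki2012, status: disputed] -/
theorem GlobalVolumeTransportAt.statement_of {m₀ : ℤ} (h : GlobalVolumeTransportAt P m₀)
    (H : BridgeHyps P) (hadm : ThetaRegionsAdm P) : P.Statement :=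
  (globalVolumeTransport_of_at h).statement_of H hadm

/-! ## 2. Per-packet ⟹ global, with the support condition DERIVED -/

/-- A function sandwiched between two finitely supported functions is finitely supported. [folklore] -/
theorem support_finite_of_sandwich {α : Type*} {f g h : α → ℝ} (h1 : ∀ a, f a ≤ g a)
    (h2 : ∀ a, g a ≤ h a) (hf : (Function.support f).Finite) (hh : (Function.support h).Finite) :
    (Function.support g).Finite := by
  refine (hf.union hh).subset fun a ha => ?_
  by_contra hc
  rw [Set.mem_union, not_or] at hc
  obtain ⟨hcf, hch⟩ := hc
  rw [Function.mem_support] at hcf hch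
  have hf0 : f a = 0 := not_not.mp hcf
  have hh0 : h a = 0 := not_not.mp hch
  have hg0 : g a = 0 :=
    le_antisymm (by rw [← hh0]; exact h2 a) (by rw [← hf0]; exact h1 a)
  exact ha hg0

/-- **The per-packet B-INPUT implies the named global form** — the per-packet ⇒ global implication of
GAP-LEDGER row G-c312-11-1-SUPPLEMENT, with the finite-support side condition DERIVED (the chosen
single-image volumes are sandwiched between `qLocal` and the hull volumes, `Setting.qSupport_finite` and
`ThetaFinite`); strengthens p413209's `globalVolumeTransport_of_pointwise`. PROVED. [folklore] -/
theorem globalVolumeTransport_of_volumeTransport (H : BridgeHyps P) (hadm : ThetaRegionsAdm P)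
    (hvt : VolumeTransport P) : GlobalVolumeTransport P := by
  choose m hm using hvt
  have hsupp : ∀ i : Fin T.lstar, (Function.support fun vQ =>
      (S.D P.n).logvol (Setting.labelSucc i) vQ
        (P.thetaRegion (m i vQ) (Setting.labelSucc i) vQ)).Finite :=
    fun i => support_finite_of_sandwich (fun vQ => hm i vQ)
      (fun vQ => logvol_thetaRegion_le_thetaLocal H hadm (m i vQ) i vQ)
      (qLocal_support_finite (Setting.labelSucc i)) (H.finite.2 i)
  exact ⟨m, hsupp, globalVolumeTransport_of_pointwise m (fun i vQ => hm i vQ) hsupp⟩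

variable (P) in
/-- The named global input is not free: wherever the Statement fails under the side conditions, it
fails too. [folklore] -/
theorem not_globalVolumeTransport_of_not_statement (H : BridgeHyps P) (hadm : ThetaRegionsAdm P)
    (h : ¬ P.Statement) : ¬ GlobalVolumeTransport P :=
  fun hgvt => h (hgvt.statement_of H hadm)

/-! ## 3. Independence at the global level (Team A's gap witness) -/

namespace GapWitness

open Cor312.Checks

/-- On Team A's gap witness, the NAMED global form fails (contrapositive of the global route through the
witness's `¬ Statement`). [folklore] -/
theorem gapSetting_not_globalVolumeTransport : ¬ GlobalVolumeTransport gapSetting :=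
  not_globalVolumeTransport_of_not_statement gapSetting gapSetting_bridgeHyps
    gapSetting_thetaRegionsAdm gapSetting_not_statement

/-- **(G3) STRONG at the (G1′) level**: a full situation satisfying the whole typed Theorem 3.11 with a
setting satisfying all bridge hypotheses, `|log(q)| > 0` and admissible Kummer images, on which the
NAMED global log-Kummer input fails — `GlobalVolumeTransport` is not derivable from the typed
interfaces. [claim: Mochizuki2012, status: disputed] -/
theorem thm311_bridgeHyps_adm_not_imp_globalVolumeTransport :
    ∃ (T : ThetaIndex) (S'' : FullSituation T) (P : Cor312.Setting S''.toSituation),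
      S''.Statement ∧ BridgeHyps P ∧ P.AbsLogQPos ∧ ThetaRegionsAdm P ∧
        ¬ GlobalVolumeTransport P :=
  ⟨toyIndex, gapFull, gapSetting, gapFull_statement, gapSetting_bridgeHyps, gapSetting_absLogQPos,
    gapSetting_thetaRegionsAdm, gapSetting_not_globalVolumeTransport⟩

end GapWitness

/-! ## 4. Non-vacuity on the nonempty toy -/

namespace Checks

/-- The named global form holds on c312-6's nonempty toy, uniformly at `m₀ = 0`. [folklore] -/
theorem globalVolumeTransportAt_toySettingNE : GlobalVolumeTransportAt toySettingNE 0 :=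
  ⟨fun _ => Set.toFinite _, le_rfl⟩

/-- The named global route runs end to end on the toy. [folklore] -/
example : toySettingNE.Statement :=
  globalVolumeTransportAt_toySettingNE.statement_of bridgeHyps_toySettingNE
    thetaRegionsAdm_toySettingNE

end Checks

end Cor312Vol

end IUTFork

end Summit.ABC

end
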